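import Summits.BirchSwinnertonDyer.Rank1Residual.X12.O11.RamifiedArchimedeanLawLineZp
import Summits.BirchSwinnertonDyer.Rank1Residual.Additive.KatoDescentRankOnePerrinRiou
import Literature.NumberTheory.EllipticCurves.FormalGroup
import HarnessLib

/-!
# O11 (CM, analytic rank one, the RAMIFIED prime): LAW RRF — the RELATIVE RAMIFIED RUBIN FORMULA, the
# cell's VALUE law of record behind the research stub `S_arch` of the line `rubin-formula-zp` (cell
# `bsd-cm`, seat `bsd-cm-ram` g10 pre-registered numerics, planner D132 (a)/D133; typed by the line owner
# `bsd-cm-k7r-c4` g8; `@[conjecture]`, NOTHING asserted)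

HONEST FRAMING. `S_arch` (`RamifiedCMArchimedeanValuationAtZp`, registered) and its ∃-free anatomy
`S_law` (`RamifiedCMArchimedeanLawAtZp`, p493282) are VALUATION statements about the rational squares
`r_m := (L_W(p^m)/L_{W₀}(p^m))²` of ratios of central Hecke `L`-values of weight `2·p^m + 2` (member `W`,
base `W₀ = 49a1^{(D₀)}`): `ord_p r_m = B(W)` above the threshold. The cell's numerical programme found and
pre-registered a VALUE law for the same sequence (seat ram g10, memo RRF-ram-g10.md v3 9006efbe4c0a4e30 =
evidence #44 on stmt-BirchSwinnertonDyer-19945; pre-registration 2289e511b4244713 = #32 BEFORE any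
computation, point prediction fixed in ADDENDUM A = #33 before the confirmation set; kit j266767/811/822/826,
j267139/140/403/404, j264773): with `σ_k(D;D₀) := ρ_k·(|D₀|/|D|)^k` (so that `σ_k² = r_k·|D|/|D₀|`),
(P6) `σ_k` is `k`-INDEPENDENT modulo `7^{1+ord₇k}` at 86/86 unit pairs, and (P7♯) **the `7`-adic limit
`σ_∞(D;D₀)` satisfies `σ_∞(D;D₀) = (|D|/|D₀|)·Rub(W_D)/Rub(W_{D₀})`, equivalently
`Q(D) := σ_∞·Rub(W_{D₀})/Rub(W_D) ≡ |D|/|D₀|` in `ℤ₇ — PASS at 33/33 members to every available digit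
(≈ 71 base-7 digits; S1 16 prime + S2 9 fresh incl. 5 composite + even-`D` members; 0 against)**, where
`Rub(W) := L′(W,1)·log_ω(P)²/(Ω_W·ĥ(P)) ∈ ℚ_7` is Rubin's 1992 expression (`P` any non-torsion point,
`ω` the Néron differential of the minimal model, `log_ω(P) := log_Ŵ([c]P)/c` for any `c` with
`[c]P ∈ Ŵ(pℤ_p)`, scale-free). READING (planner D132/D133, referee g42 desk countersign PASS, conditional):
granting [BKNO] Thm. 4.12/1.8 this says `ℒ_{p,v_ε}(φ_D)(𝟙) ≐ C·L′(E_D,1)·log_ω(P)²/(|D|·Ω_{E_D}·ĥ(P))` on 𝒞₇ —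
Rubin's `p`-adic formula (Invent. Math. 107 (1992), split `p`) TRANSPLANTED TO THE RAMIFIED (additive)
PRIME, read RELATIVELY to the unit member; its valuation is `(★)_D − (★)_{D₀}` (memo §1 (R0)–(R1):
`B(D) = 2·ord₇Rub(W_D)`), i.e. `S_law`; its conjectural SOURCE is THEOREM R: PR^×(E_D,7) ∧ PR^×(E_{D₀},7)
(+ (R2)–(R4)) with PR^× = `Additive.PerrinRiouUpToUnitAt` — NOTHING of this is in print at an additive
prime (BKNO §1.4 «report elsewhere»; BSTW 2024 Thm. 6.4 needs `p ∤ 2N`; BKO 2024 = inert good `p`; Rubin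
1992 = split `p`). THIS FILE types the law in the line's own currency, fact-free:

* `padicRubinValue W p P qL c` — `Rub(W)` read in `ℚ_p`: `qL · (log_Ŵ([c]·P_p)/c)²` with `qL ∈ ℚ` the
  Gross–Zagier rational `L′(W,1)/(Ω_W·Reg W)` (a BINDER of the law, as in `Additive.PerrinRiouUpToUnitAt`:
  `W.leadingLCoeff / (W.realPeriodRat · W.regulator) = qL`; `Reg W = ĥ(P)` for the generator `P`),
  `P_p = W.toPadicPoint p P`, `log_Ŵ` the tree's `padicLogPoint` of the (minimal) model over `ℚ_p`.
* `RamifiedCMRelativeRubinFormulaAtZp W p D₀` (**LAW RRF**, `@[conjecture]`): at every analytic-rank-one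
  O11 frame of `(W, p)`, for every twist parameter `D` with `∃ C, C • W = cm7.quadraticTwist D` (THE TESTED
  FAMILY: models of `49a1^{(D)}`), every generator `P` of `W(ℚ)` modulo torsion with its GZ rational `qL`,
  every globally minimal model `W₀` of `cm7^{(D₀)}` with generator `P₀` and rational `qL₀`, every `c ≠ 0`
  putting `[c]P_p`, `[c]P₀,p` in the kernels of reduction, and every rational sequence `r` with
  `(heckePowerCentralValue φ (p^m)/heckePowerCentralValue φ₀ (p^m))² = r m` for pinned `φ`, `φ₀`:
  `r m → (|D|/|D₀|) · (Rub(W)/Rub(W₀))²` in `ℚ_p` as `m → ∞`.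
  STATUS: CONJECTURE OF THE CELL (pre-registered numerical law, 33/33, 0 against); not in print; its
  valuation content above the threshold is `S_law`; nothing asserted; BSD is not proved by any of this.

References: K. Rubin, Invent. Math. 107 (1992) (the split-prime formula) [Rubin1992]; [BKNO] arXiv:2608.06879v1
Thm. 1.5/4.12, Thm. 1.8/7.2, §1.4 [BurungaleKobayashiNakamuraOta2026]; B. Perrin-Riou, Ann. Inst. Fourier 43
(1993) §3.3 [PerrinRiou1993AIF]; D. Burns, M. Kurihara, T. Sano (2019) Thm. 1.4 / Conj. 1.5 [BurnsKuriharaSano2019];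
A. Burungale, S. Kobayashi, K. Ota, J. Inst. Math. Jussieu 23 (2024) Thm. 1.1 (inert good `p`) [BurungaleKobayashiOta2023];
B. Gross, D. Zagier (1986) I.(7.3) [GrossZagier1986]; J. Silverman AEC IV.6.4, VII.2.2 (formal logarithm)
[SilvermanAEC2009]; cell texts PREREG-RRF-ram-g10.md (+ addenda A/B), RRF-ram-g10.md v3 §1–§2, STATUS D132/D133.
-/

noncomputable section

open scoped Classical Topology

open Filter WeierstrassCurve NumberField IsDedekindDomain Field
  Literature.NumberTheory.EllipticCurves
  Literature.NumberTheory.EllipticCurves.Rank1Residual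
  Literature.NumberTheory.GaloisRepresentations
  Literature.NumberTheory.DiophantineGeometry
  Summit.BirchSwinnertonDyer.Rank1Residual.Additive

namespace Summit.BirchSwinnertonDyer.Rank1Residual.X12.O11

section RelativeRubinFormulaLineZp

variable (W : WeierstrassCurve ℚ) [W.IsElliptic] [W.IsGloballyMinimal] (p : ℕ) [Fact p.Prime] (D₀ : ℤ)

/-- **Rubin's expression read in `ℚ_p`**: `Rub(W) = qL · (log_Ŵ([c]·P_p)/c)²`, where `qL ∈ ℚ` stands for the
Gross–Zagier rational `L′(W,1)/(Ω_W · Reg W)` (a binder of the law below), `P_p = W.toPadicPoint p P` is the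
rational point in `W(ℚ_p)`, `log_Ŵ` is the `p`-adic formal logarithm `padicLogPoint` of the model `W ⊗ ℚ_p`
(the Néron differential's logarithm when `W` is minimal at `p`), and `c ≠ 0` is any multiplier putting
`[c]P_p` in the kernel of reduction (`c = 14 = c₇·#Ẽ_ns(𝔽₇)` on 𝒞₇); scale-free in `(P, c)` granted the
homomorphism property of `log_Ŵ` (tree fact `padicLogPoint_add`, not used). Seat ram's `Rub(W) =
L′(W,1)·log_ω(P)²/(Ω_W·ĥ(P))` with `ĥ(P) = Reg W` for a generator. [cite: Rubin1992, Thm. 1 (shape of the expression; split p)]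
[cite: BurnsKuriharaSano2019, Thm. 1.4 (p. 4) (shape only)] -/
def padicRubinValue (P : W.toAffine.Point) (qL : ℚ) (c : ℕ) : ℚ_[p] :=
  (qL : ℚ_[p]) * ((W.baseChange ℚ_[p]).padicLogPoint (c • W.toPadicPoint p P) / (c : ℚ_[p])) ^ 2

/-- **LAW RRF — THE RELATIVE RAMIFIED RUBIN FORMULA (typed numerical law of the cell; `@[conjecture]`;
nothing asserted).** At every analytic-rank-one O11 frame `(K, 𝔭, W', C)` of `(W, p)`: for every twist
parameter `D : ℤ` with `∃ C₁, C₁ • W = cm7.quadraticTwist D` (so `W` is a model of `49a1^{(D)}` — the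
tested family), every `P ∈ W(ℚ)` generating modulo torsion with Gross–Zagier rational `qL`
(`W.leadingLCoeff / (W.realPeriodRat · W.regulator) = qL`), every Hecke character `φ` pinned to `W`, every
globally minimal model `W₀` of `cm7^{(D₀)}` with generator `P₀`, rational `qL₀` and pinned `φ₀`, every
`c ≠ 0` with `[c]P_p`, `[c]P₀,p` in the kernels of reduction, and every sequence `r : ℕ → ℚ` with
`(heckePowerCentralValue φ (p^m) / heckePowerCentralValue φ₀ (p^m))² = r m` for all `m`:
`r m ⟶ (|D|/|D₀|) · (Rub(W)/Rub(W₀))²` in `ℚ_p` (`m → ∞`), `Rub = padicRubinValue`. (In seat ram's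
notation: `σ_{p^m}² = r_m·|D|/|D₀|` and RRF♯ `σ_∞ = (|D|/|D₀|)·Rub(W)/Rub(W₀)`.) EVIDENCE (p = 7, D₀ = −11):
pre-registered (evidence #32/#33 on 19945, before computation), PASS 33/33 members to every available
digit, 0 against (memo RRF-ram-g10.md v3 = #44; kit j266811/j266826/j267139/j267140/j267403 …); referee g42
desk countersign of the reduction THEOREM R: PASS (conditional). READING: granting [BKNO] Thm. 4.12/1.8,
`ℒ_{p,v_ε}(φ_D)(𝟙) ≐ C·L′(E_D,1)·log_ω(P)²/(|D|·Ω·ĥ(P))` — Rubin's 1992 split-prime formula transplanted to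
the RAMIFIED prime, relative to the base member; valuation content above the threshold = `S_law`
(`RamifiedCMArchimedeanLawAtZp`, via (R0) `B(D) = 2·ord₇ Rub(W_D)`); conjectural source = PR^×
(`Additive.PerrinRiouUpToUnitAt`) at `(E_D, p)` and at the base via THEOREM R. NOT IN PRINT at an additive
prime. CONJECTURE; nothing asserted; BSD is not proved by any of this.
[cite: Rubin1992, Thm. 1 (split p; shape only)] [cite: BurungaleKobayashiNakamuraOta2026, Thm. 1.8 and §1.4 (arXiv:2608.06879 pp. 7–8) (claim; preprint; shape only)]
[cite: GrossZagier1986, Thm. I.(7.3) (rationality of L′/(Ω·Reg))] -/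
@[conjecture] def RamifiedCMRelativeRubinFormulaAtZp : Prop :=
  ∀ (K : Type) [Field K] [NumberField K] (𝔭 : HeightOneSpectrum (𝓞 K))
    (W' : WeierstrassCurve ℚ) [W'.IsElliptic] [W'.IsGloballyMinimal] (C : VariableChange ℚ),
    IsFrame W p K 𝔭 W' C → W.analyticRank = 1 →
    ∀ (D : ℤ), (∃ C₁ : VariableChange ℚ, C₁ • W = cm7.quadraticTwist (D : ℚ)) →
    ∀ (P : W.toAffine.Point) (qL : ℚ),
      ¬ IsOfFinAddOrder P →
      (∀ R : W.toAffine.Point, ∃ (k : ℤ) (T : W.toAffine.Point), IsOfFinAddOrder T ∧ R = k • P + T) →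
      W.leadingLCoeff / ((W.realPeriodRat : ℂ) * (W.regulator : ℂ)) = (qL : ℂ) →
    ∀ (φ : HeckeCharacter K), (∀ s : ℂ, 3 / 2 < s.re → heckeLFunction φ s = W.LSeries s) →
    ∀ (W₀ : WeierstrassCurve ℚ) [W₀.IsElliptic] [W₀.IsGloballyMinimal],
      (∃ C₀ : VariableChange ℚ, C₀ • W₀ = cm7.quadraticTwist (D₀ : ℚ)) →
    ∀ (P₀ : W₀.toAffine.Point) (qL₀ : ℚ),
      ¬ IsOfFinAddOrder P₀ →
      (∀ R : W₀.toAffine.Point, ∃ (k : ℤ) (T : W₀.toAffine.Point), IsOfFinAddOrder T ∧ R = k • P₀ + T) →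
      W₀.leadingLCoeff / ((W₀.realPeriodRat : ℂ) * (W₀.regulator : ℂ)) = (qL₀ : ℂ) →
    ∀ (φ₀ : HeckeCharacter K), (∀ s : ℂ, 3 / 2 < s.re → heckeLFunction φ₀ s = W₀.LSeries s) →
    ∀ (c : ℕ), c ≠ 0 →
      (W.baseChange ℚ_[p]).IsInReductionKernel (c • W.toPadicPoint p P) →
      (W₀.baseChange ℚ_[p]).IsInReductionKernel (c • W₀.toPadicPoint p P₀) →
    ∀ (r : ℕ → ℚ),
      (∀ m : ℕ, (heckePowerCentralValue φ (p ^ m) / heckePowerCentralValue φ₀ (p ^ m)) ^ 2 = (r m : ℂ)) →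
      Tendsto (fun m : ℕ => ((r m : ℚ) : ℚ_[p])) atTop
        (𝓝 ((((D.natAbs : ℕ) : ℚ_[p]) / ((D₀.natAbs : ℕ) : ℚ_[p])) *
          (padicRubinValue W p P qL c / padicRubinValue W₀ p P₀ qL₀ c) ^ 2))

end RelativeRubinFormulaLineZp

end Summit.BirchSwinnertonDyer.Rank1Residual.X12.O11

end
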